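import Summits.CriticalPhenomena.PercolationContinuityZ3.Theorems.Transplant.FKDoubleFanD3CoreCells
import Summits.CriticalPhenomena.PercolationContinuityZ3.Theorems.Transplant.FKDoubleFanWordCellsB3Free
import HarnessLib

/-!
# Double fans `K₂ ∨ P_{m+1}`: the generator `𝟙` is an EIGENVECTOR of the rim polarisation `T_D` — the `𝟙`-row and the `𝟙`-column of
# the two core word-families `(1,1,1)`, `(1,1,2)|_{y2 = 0}` are cells of shorter / free families

Helper file (`--supports stmt-CriticalPhenomena-4575`), FK sub-lane `prim-bschramm-fk-3` (gen 51); builds on p205010 (kernel theorem, internal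
audit signed; external expert review pending).  No named facts, no sorries, default heartbeats; standard axioms.  Memo
`bschramm/prim-bschramm-fk-3/FAR-CROSS-XXVI.md` §1.

After «…D3CoreCells» the cross-apex pair at rim distance three, for an ARBITRARY spoke pattern and `q ∈ [1/2,1]`, follows from the parts of the two
word-families `PartsOK q 1 1 1 x1 y1 x2 y2` and `PartsOK q 1 1 2 x1 y1 x2 0`, each reduced to its 16 core pairs `{AC, 𝟙, R₀(w), R₁(w)}²`
(`partsOK_of_core16`).  This file removes the generator `𝟙` from both: the input bivector `u ∧ P_a u` of the all-equal product vector
`𝟙 = δ₀` and its target mirror are EIGENVECTORS of `T_D` with eigenvalue `q` (**`opTD_inputBiv_rayOne`**, **`opTD_targetBiv_rayOne`** — the vacuum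
`δ₀` is reproduced by the detach flow).  Hence a first rim letter `T_D` against the input `𝟙` and a last rim letter `T_D` against the target `𝟙` are
the scalar `q` (**`pcell2_firstT_rayOne`**, **`pcell2_lastT_rayOne`**), and with «…WordCellsEdgeSpokes» (the spoke next to an identity end letter is a
scalar):
* **`pcell2_firstT_rayOne_eq`**: `pcell2 q 1 k1 k2 x1 y1 x2 y2 𝟙 S = q(1−x1)·pcell2 q 2 k1 k2 0 y1 x2 y2 𝟙 S`;
* **`pcell2_lastT_rayOne_eq`**: `pcell2 q k0 k1 1 x1 y1 x2 y2 P 𝟙 = q(1−y2)·pcell2 q k0 k1 2 x1 y1 x2 0 P 𝟙`.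
Consequences (`q ∈ [1/2,1]`, spokes in `[0,1]`): the `𝟙`-ROW of the family `(1,1,2)` is a cell of the word `(2,1,2)`, i.e. a MIN cell, hence `≥ 0`
(**`pcell2_112_rayOne_row_nonneg`**, from `partsOK_212`); the `𝟙`-column of `(1,1,1)` is `q(1−y2)` times the `𝟙`-column of `(1,1,2)|_{y2=0}` and its
`𝟙`-row is, by the mirror, `q(1−x1)` times the `𝟙`-column of `(1,1,2)|_{y2=0}` at the spokes `(y2,x2,y1)`.  So (**`partsOK_112_of_core12`**,
**`partsOK_111_of_core9`**) the parts of `(1,1,2)|_{y2=0}` follow from its 12 pairs `{AC,R₀,R₁} × {AC,𝟙,R₀,R₁}` and the parts of `(1,1,1)` from its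
9 pairs `{AC,R₀,R₁}²` together with the `𝟙`-column of `(1,1,2)|_{y2=0}` at two spoke triples; and (**`negCorr_spokes_cross_three_of_core21`**) the
measure-level distance-3 statement for every weighted double fan needs exactly these 12 + 9 families of polynomial inequalities.
[cite: Grimmett2006, §3.9 eq. (3.94) (pp. 63–64)] [folklore]
-/

noncomputable section

namespace Summit.CriticalPhenomena.PercolationContinuityZ3.Theorems

namespace FK

namespace ThreeApex

/-! ### `𝟙` is an eigenvector of `T_D` on both sides -/

/-- **`T_D (u ∧ P_a u) = q·(u ∧ P_a u)` for the all-equal product vector `𝟙`.** [folklore] -/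
theorem opTD_inputBiv_rayOne (q : ℝ) : opTD q (inputBiv rayOne) = Biv.smul q (inputBiv rayOne) := by
  ext <;> simp only [opTD, inputBiv, rayOne, Biv.smul] <;> ring

/-- **`T_D (s ∧ P_b s) = q·(s ∧ P_b s)` for the all-equal product vector `𝟙`.** [folklore] -/
theorem opTD_targetBiv_rayOne (q : ℝ) : opTD q (targetBiv rayOne) = Biv.smul q (targetBiv rayOne) := by
  ext <;> simp only [opTD, targetBiv, rayOne, Biv.smul] <;> ring

/-- **A first rim letter `T_D` against the input `𝟙` is the scalar `q`.** [folklore] -/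
theorem pcell2_firstT_rayOne (q : ℝ) (k1 k2 : ℕ) (x1 y1 x2 y2 : ℝ) (S : P6) :
    pcell2 q 1 k1 k2 x1 y1 x2 y2 rayOne S = q * pcell2 q 2 k1 k2 x1 y1 x2 y2 rayOne S := by
  have h1 : ∀ γ : Biv, rimOp q 1 γ = opTD q γ := fun _ => rfl
  have h2 : ∀ γ : Biv, rimOp q 2 γ = γ := fun _ => rfl
  unfold pcell2
  rw [h1, h2, opTD_inputBiv_rayOne, opBC_smul', opAC_smul, rimOp_smul, opBC_smul', opAC_smul, rimOp_smul, pairH_smul_left]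

/-- **A last rim letter `T_D` against the target `𝟙` is the scalar `q`.** [folklore] -/
theorem pcell2_lastT_rayOne (q : ℝ) (k0 k1 : ℕ) (x1 y1 x2 y2 : ℝ) (P : P6) :
    pcell2 q k0 k1 1 x1 y1 x2 y2 P rayOne = q * pcell2 q k0 k1 2 x1 y1 x2 y2 P rayOne := by
  have h1 : ∀ γ : Biv, rimOp q 1 γ = opTD q γ := fun _ => rfl
  have h2 : ∀ γ : Biv, rimOp q 2 γ = γ := fun _ => rfl
  unfold pcell2
  rw [h1, h2, pairH_opTD, opTD_targetBiv_rayOne, pairH_smul_right]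

/-- **The `𝟙`-row of `(1,k1,k2)`**: `pcell2 q 1 k1 k2 x1 y1 x2 y2 𝟙 S = q(1−x1)·pcell2 q 2 k1 k2 0 y1 x2 y2 𝟙 S`. [folklore] -/
theorem pcell2_firstT_rayOne_eq (q : ℝ) (k1 k2 : ℕ) (x1 y1 x2 y2 : ℝ) (S : P6) :
    pcell2 q 1 k1 k2 x1 y1 x2 y2 rayOne S = q * (1 - x1) * pcell2 q 2 k1 k2 0 y1 x2 y2 rayOne S := by
  rw [pcell2_firstT_rayOne, pcell2_firstI, mul_assoc]

/-- **The `𝟙`-column of `(k0,k1,1)`**: `pcell2 q k0 k1 1 x1 y1 x2 y2 P 𝟙 = q(1−y2)·pcell2 q k0 k1 2 x1 y1 x2 0 P 𝟙`. [folklore] -/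
theorem pcell2_lastT_rayOne_eq (q : ℝ) (k0 k1 : ℕ) (x1 y1 x2 y2 : ℝ) (P : P6) :
    pcell2 q k0 k1 1 x1 y1 x2 y2 P rayOne = q * (1 - y2) * pcell2 q k0 k1 2 x1 y1 x2 0 P rayOne := by
  rw [pcell2_lastT_rayOne, pcell2_lastI, mul_assoc]

/-! ### The `𝟙`-row of the family `(1,1,2)` is a MIN cell -/

section Core

variable {q x1 y1 x2 y2 : ℝ}

/-- **The `𝟙`-row of `(1,1,2)` is free** (`q ∈ [1/2,1]`): `0 ≤ pcell2 q 1 1 2 x1 y1 x2 y2 𝟙 S` at every generator `S` — it is `q` times a cell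
of the word `(2,1,2)`, a MIN cell (`partsOK_212`). [folklore] -/
theorem pcell2_112_rayOne_row_nonneg (hq0 : 1 / 2 ≤ q) (hq1 : q ≤ 1) (hx11 : x1 ≤ 1) (hy10 : 0 ≤ y1) (hy11 : y1 ≤ 1) (hx20 : 0 ≤ x2)
    (hx21 : x2 ≤ 1) (hy21 : y2 ≤ 1) {S : P6} (hS : IsGenP q S) : 0 ≤ pcell2 q 1 1 2 x1 y1 x2 y2 rayOne S := by
  rw [pcell2_firstT_rayOne]
  exact mul_nonneg (by linarith) (partsOK_212 hq0 hq1 hx11 hy10 hy11 hx20 hx21 hy21 _ _ (isGenP_rayOne q) hS)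

/-- **The family `(1,1,2)|_{y2=0}` reduces to 12 pairs**: `PartsOK q 1 1 2 x1 y1 x2 0` follows from the polarized cells at `P ∈ {AC, R₀(w), R₁(w)}`
(i.e. `P ≠ A, D, BD, 𝟙`) and `S ∈ {AC, 𝟙, R₀(w'), R₁(w')}` (`q ∈ [1/2,1]`, spokes in `[0,1]`). [folklore] -/
theorem partsOK_112_of_core12 (hq0 : 1 / 2 ≤ q) (hq1 : q ≤ 1) (hx10 : 0 ≤ x1) (hx11 : x1 ≤ 1) (hy10 : 0 ≤ y1) (hy11 : y1 ≤ 1)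
    (hx20 : 0 ≤ x2) (hx21 : x2 ≤ 1)
    (h : ∀ P S : P6, IsGenP q P → IsGenP q S → P ≠ rayA → P ≠ rayD → P ≠ rayBD → P ≠ rayOne → S ≠ rayA → S ≠ rayD → S ≠ rayBD →
      0 ≤ pcell2 q 1 1 2 x1 y1 x2 0 P S) :
    PartsOK q 1 1 2 x1 y1 x2 0 := by
  refine partsOK_of_core16 (by linarith) hq1 hx10 hx11 hy10 hy11 hx20 hx21 le_rfl zero_le_one
    (fun P S hP hS hPA hPD hPB hSA hSD hSB => ?_)
  by_cases hP1 : P = rayOne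
  · subst hP1; exact pcell2_112_rayOne_row_nonneg hq0 hq1 hx11 hy10 hy11 hx20 hx21 zero_le_one hS
  exact h P S hP hS hPA hPD hPB hP1 hSA hSD hSB

/-- **The family `(1,1,1)` reduces to 9 pairs and the `𝟙`-column of `(1,1,2)|_{y2=0}`**: `PartsOK q 1 1 1 x1 y1 x2 y2` follows from its polarized
cells at `P, S ∈ {AC, R₀(w), R₁(w)}` together with the `𝟙`-column of `(1,1,2)|_{y2=0}` at the spoke triples `(x1,y1,x2)` and `(y2,x2,y1)`
(`q ∈ [1/2,1]`, spokes in `[0,1]`). [folklore] -/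
theorem partsOK_111_of_core9 (hq0 : 1 / 2 ≤ q) (hq1 : q ≤ 1) (hx10 : 0 ≤ x1) (hx11 : x1 ≤ 1) (hy10 : 0 ≤ y1) (hy11 : y1 ≤ 1)
    (hx20 : 0 ≤ x2) (hx21 : x2 ≤ 1) (hy20 : 0 ≤ y2) (hy21 : y2 ≤ 1)
    (hcol : ∀ P : P6, IsGenP q P → P ≠ rayA → P ≠ rayD → P ≠ rayBD → P ≠ rayOne → 0 ≤ pcell2 q 1 1 2 x1 y1 x2 0 P rayOne)
    (hcol' : ∀ S : P6, IsGenP q S → S ≠ rayA → S ≠ rayD → S ≠ rayBD → S ≠ rayOne → 0 ≤ pcell2 q 1 1 2 y2 x2 y1 0 S rayOne)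
    (h : ∀ P S : P6, IsGenP q P → IsGenP q S → P ≠ rayA → P ≠ rayD → P ≠ rayBD → P ≠ rayOne → S ≠ rayA → S ≠ rayD → S ≠ rayBD →
      S ≠ rayOne → 0 ≤ pcell2 q 1 1 1 x1 y1 x2 y2 P S) :
    PartsOK q 1 1 1 x1 y1 x2 y2 := by
  have hq : (0:ℝ) ≤ q := by linarith
  refine partsOK_of_core16 hq hq1 hx10 hx11 hy10 hy11 hx20 hx21 hy20 hy21 (fun P S hP hS hPA hPD hPB hSA hSD hSB => ?_)
  by_cases hS1 : S = rayOne
  · subst hS1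
    rw [pcell2_lastT_rayOne_eq]
    refine mul_nonneg (mul_nonneg hq (sub_nonneg.2 hy21)) ?_
    by_cases hP1 : P = rayOne
    · subst hP1; exact pcell2_112_rayOne_row_nonneg hq0 hq1 hx11 hy10 hy11 hx20 hx21 zero_le_one (isGenP_rayOne q)
    · exact hcol P hP hPA hPD hPB hP1
  by_cases hP1 : P = rayOne
  · subst hP1
    rw [pcell2_mirror, pcell2_lastT_rayOne_eq]
    exact mul_nonneg (mul_nonneg hq (sub_nonneg.2 hx11)) (hcol' S hS hSA hSD hSB hS1)
  exact h P S hP hS hPA hPD hPB hP1 hSA hSD hSB hS1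

end Core

/-! ### Measure level: distance three from the 12 + 9 core families -/

open MeasureTheory Literature.Probability.LatticeModels Literature.Probability.Percolation
open scoped Classical

variable {V : Type*} [Fintype V]
variable {a b : V} {c : ℕ → V} {m : ℕ}
variable (hab : a ≠ b) (hinj : ∀ j k, j ≤ m → k ≤ m → c j = c k → j = k) (hca : ∀ j, j ≤ m → c j ≠ a) (hcb : ∀ j, j ≤ m → c j ≠ b)
include hab hinj hca hcb

/-- **Cross-apex pair at rim distance three, ARBITRARY spoke pattern, `q ∈ [1/2, 1]`, from the 12 + 9 core families.**  For a weighted double fan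
(`card V = m+3`, weights supported on the double-fan pairs) and `j + 3 ≤ m`: if, at all spoke weights in `[0,1]`, the polarized cells of the word
`(1,1,2)|_{y2=0}` are `≥ 0` at the 12 pairs `{AC,R₀,R₁} × {AC,𝟙,R₀,R₁}` and those of the word `(1,1,1)` at the 9 pairs `{AC,R₀,R₁}²`, then
`φ(J_{a c_j} ∩ J_{b c_{j+3}}) ≤ φ(J_{a c_j}) · φ(J_{b c_{j+3}})`. [cite: Grimmett2006, §3.9 eq. (3.94) (pp. 63–64)] -/
theorem negCorr_spokes_cross_three_of_core21 (hcard : Fintype.card V = m + 3) {q : ℝ} (hq0 : 1 / 2 ≤ q) (hq1 : q ≤ 1)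
    (H112 : ∀ x1 y1 x2 : ℝ, 0 ≤ x1 → x1 ≤ 1 → 0 ≤ y1 → y1 ≤ 1 → 0 ≤ x2 → x2 ≤ 1 →
      ∀ P S : P6, IsGenP q P → IsGenP q S → P ≠ rayA → P ≠ rayD → P ≠ rayBD → P ≠ rayOne → S ≠ rayA → S ≠ rayD → S ≠ rayBD →
        0 ≤ pcell2 q 1 1 2 x1 y1 x2 0 P S)
    (H111 : ∀ x1 y1 x2 y2 : ℝ, 0 ≤ x1 → x1 ≤ 1 → 0 ≤ y1 → y1 ≤ 1 → 0 ≤ x2 → x2 ≤ 1 → 0 ≤ y2 → y2 ≤ 1 →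
      ∀ P S : P6, IsGenP q P → IsGenP q S → P ≠ rayA → P ≠ rayD → P ≠ rayBD → P ≠ rayOne → S ≠ rayA → S ≠ rayD → S ≠ rayBD →
        S ≠ rayOne → 0 ≤ pcell2 q 1 1 1 x1 y1 x2 y2 P S)
    (w : Sym2 V → unitInterval) (hsupp : ∀ e, e ∉ dfPairs a b c m → w e = 0) {j : ℕ} (hj : j + 2 + 1 ≤ m) :
    (rcMeasureW w q ∅).real ({ω : BondConfig V | s(a, c j) ∈ ω} ∩ {ω | s(b, c (j + 2 + 1)) ∈ ω}) ≤
      (rcMeasureW w q ∅).real {ω : BondConfig V | s(a, c j) ∈ ω} *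
        (rcMeasureW w q ∅).real {ω : BondConfig V | s(b, c (j + 2 + 1)) ∈ ω} := by
  refine negCorr_spokes_cross_three_of_core hab hinj hca hcb hcard hq0 hq1 ?_ ?_ w hsupp hj
  · intro x1 y1 x2 y2 hx10 hx11 hy10 hy11 hx20 hx21 hy20 hy21
    exact partsOK_111_of_core9 hq0 hq1 hx10 hx11 hy10 hy11 hx20 hx21 hy20 hy21
      (fun P hP hPA hPD hPB hP1 => H112 x1 y1 x2 hx10 hx11 hy10 hy11 hx20 hx21 P rayOne hP (isGenP_rayOne q) hPA hPD hPB hP1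
        (by simp [rayOne, rayA]) (by simp [rayOne, rayD]) (by simp [rayOne, rayBD]))
      (fun S hS hSA hSD hSB hS1 => H112 y2 x2 y1 hy20 hy21 hx20 hx21 hy10 hy11 S rayOne hS (isGenP_rayOne q) hSA hSD hSB hS1
        (by simp [rayOne, rayA]) (by simp [rayOne, rayD]) (by simp [rayOne, rayBD]))
      (H111 x1 y1 x2 y2 hx10 hx11 hy10 hy11 hx20 hx21 hy20 hy21)
  · intro x1 y1 x2 hx10 hx11 hy10 hy11 hx20 hx21
    exact partsOK_112_of_core12 hq0 hq1 hx10 hx11 hy10 hy11 hx20 hx21 (H112 x1 y1 x2 hx10 hx11 hy10 hy11 hx20 hx21)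

end ThreeApex

end FK

end Summit.CriticalPhenomena.PercolationContinuityZ3.Theorems
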